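import Summits.CriticalPhenomena.CardyFormulaZ2.Theses.CardyWickAnisotropy
import HarnessLib

/-!
# Stub `stub_firstJetRusso` of line `birth`, crux `CardyWickAnisotropy.AnisotropicBoxCardy`
(stmt-CriticalPhenomena-14309): Russo's form of the first jet at the self-dual point

`V n p = Σ_{ω ⊆ E n} 1[ω ∈ LR(R_n)] Π_{e ∈ E n} (w_p e if e ∈ ω else 1 - w_p e)` is the
complex-anisotropy crossing amplitude of the self-dual box `R_n = [0, n+1] × [0, n]`, with weight
`w_p e = p` on horizontal and `1 - p` on vertical bonds. Its derivative at `p = 1/2` is the signed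
pivotal expectation `E_½[N^piv_h − N^piv_v](R_n)`, written as the finite count
`Piv n = Σ_e (±1) · 2 · #{ω ⊆ E n ∖ e : insert e ω ∈ LR, ω ∉ LR} / 2^|E n|` (`+` on horizontal,
`−` on vertical bonds). The identity is exact for every `n`.

Proof: pure finite calculus. Every factor of every summand is affine in `p`, equal to `1/2` at
`p = 1/2`, with slope `(±1)_{e ∈ ω} · (±1)_{e horizontal}`; differentiate term by term
(`HasDerivAt.fun_sum`, `HasDerivAt.fun_finsetProd`), exchange the two sums and pair
`ω ↔ insert e ω` over `ω ⊆ (E n).erase e` (`Finset.sum_powerset_insert`); monotonicity of the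
crossing event (`Literature.Probability.Percolation.isUpperSet_lrCrossing`) turns
`1[insert e ω ∈ LR] − 1[ω ∈ LR]` into the indicator of `insert e ω ∈ LR ∧ ω ∉ LR`, and
`(1/2)^(|E n| − 1) = 2 / 2^|E n|`.

Elaboration note. In the registered signature the pivotal count is written
`(((E n).erase e).powerset.filter (fun ω ↦ (↑(insert e ω) : Set _) ∈ LR ∧ (↑ω : Set _) ∉ LR)).card`
with an untyped binder `ω`; Lean types `ω` as a *set* and coerces the finset of finsets
`((E n).erase e).powerset` to a finset of sets through the (classical) `Finset` monad,
`S ↦ S >>= pure ∘ (↑)`, i.e. its image under the injective coercion. The count is the intended one;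
`card_filter_coe_finset` below moves it back to finsets. The statements of this file repeat the
registered text verbatim, so they elaborate identically.
-/

namespace Summit.CriticalPhenomena.CardyFormulaZ2.Theorems

open scoped Classical

universe u

/-! ### Abstract bookkeeping: the two-colour cylinder polynomial at the symmetric point -/

/-- An `if` with else-branch `0` commutes with a finite sum. -/
private theorem ite_sum_else_zero {κ : Type*} (s : Finset κ) (P : Prop) [Decidable P]
    (g : κ → ℂ) : (if P then ∑ k ∈ s, g k else 0) = ∑ k ∈ s, (if P then g k else 0) := by
  split_ifs <;> simp

/-- The monadic coercion `S ↦ S >>= pure ∘ (↑)` of a finset of finsets to a finset of sets (the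
classical `Finset` monad) is the image under the injective coercion, so filtering and counting
downstairs is filtering and counting upstairs. -/
private theorem card_filter_coe_finset {ι : Type u} (S : Finset (Finset ι)) (P : Set ι → Prop)
    [DecidablePred P] :
    (Finset.filter P (S : Finset (Set ι))).card = (S.filter (fun ω : Finset ι ↦ P ↑ω)).card := by
  have h1 : (S : Finset (Set ι)) = S.image (fun ω : Finset ι ↦ (↑ω : Set ι)) := by
    ext s
    simp [eq_comm]
  rw [h1, Finset.filter_image, Finset.card_image_of_injective _ Finset.coe_injective]

/-- Pairing `ω ↔ insert e ω`: for an increasing event `A`, an element `e ∈ K` and constants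
`a`, `t`,
`Σ_{ω ⊆ K} 1[ω ∈ A] · a · ((±1)_{e ∈ ω} · t) = a · t · #{ω ⊆ K ∖ e : insert e ω ∈ A, ω ∉ A}`
(the two members of a pair cancel unless exactly the larger one lies in `A`). The right-hand
count is written as in the registered signature (see the elaboration note in the module
docstring). -/
private theorem sum_powerset_ite_mul_sign {ι : Type u} [DecidableEq ι] {K : Finset ι} {e : ι}
    (he : e ∈ K) {A : Set (Set ι)} (hA : IsUpperSet A) (a t : ℂ) :
    (∑ ω ∈ K.powerset,
        if (↑ω : Set ι) ∈ A then a * ((if e ∈ ω then (1:ℂ) else -1) * t) else 0) =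
      a * t * (((K.erase e).powerset.filter
        (fun ω ↦ (↑(insert e ω) : Set ι) ∈ A ∧ (↑ω : Set ι) ∉ A)).card : ℂ) := by
  have hpow : K.powerset = (insert e (K.erase e)).powerset := by rw [Finset.insert_erase he]
  rw [hpow, Finset.sum_powerset_insert (Finset.notMem_erase e K), ← Finset.sum_add_distrib,
    card_filter_coe_finset, Finset.natCast_card_filter, Finset.mul_sum]
  refine Finset.sum_congr rfl fun ω hω ↦ ?_
  have heω : e ∉ ω := fun h ↦ Finset.notMem_erase e K (Finset.mem_powerset.1 hω h)
  have hei : e ∈ insert e ω := Finset.mem_insert_self e ω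
  by_cases hωA : (↑ω : Set ι) ∈ A
  · have hiA : insert e (↑ω : Set ι) ∈ A := hA (Set.subset_insert e _) hωA
    have hiA' : (↑(insert e ω) : Set ι) ∈ A := by rwa [Finset.coe_insert]
    simp only [hωA, hiA, hiA', heω, hei, if_true, if_false, not_true, and_false]
    ring
  · by_cases hiA : insert e (↑ω : Set ι) ∈ A
    · have hiA' : (↑(insert e ω) : Set ι) ∈ A := by rwa [Finset.coe_insert]
      simp only [hωA, hiA, hiA', heω, hei, if_true, if_false, not_false_eq_true, and_self]
      ring
    · have hiA' : (↑(insert e ω) : Set ι) ∉ A := by rwa [Finset.coe_insert]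
      simp only [hωA, hiA, hiA', heω, hei, if_true, if_false, false_and]
      ring

/-- **The first jet of the two-colour cylinder polynomial at the symmetric point.** Let `A` be an
increasing event of subsets of `ι`, `K` a finite set, `hor` a predicate ("horizontal"), and
`w p e = p` if `hor e`, `1 - p` otherwise. Then
`V p = Σ_{ω ⊆ K} 1[ω ∈ A] Π_{e ∈ K} (w p e if e ∈ ω else 1 - w p e)` has derivative
`Σ_{e ∈ K} (±1)_{hor e} · 2 · #{ω ⊆ K ∖ e : insert e ω ∈ A, ω ∉ A} / 2^|K|` at `p = 1/2`
(Russo's formula for the product measure with all parameters `1/2`, as an exact finite identity: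
every factor is affine with value `1/2` at `1/2` and slope `(±1)_{e ∈ ω} (±1)_{hor e}`; pair
`ω ↔ insert e ω`). The count is written as in the registered signature. -/
private theorem hasDerivAt_twoColourCylinder_half {ι : Type u} [DecidableEq ι] (K : Finset ι)
    {A : Set (Set ι)} (hA : IsUpperSet A) (hor : ι → Prop) [DecidablePred hor]
    (w : ℂ → ι → ℂ) (hw : ∀ p e, w p e = if hor e then p else 1 - p)
    (V : ℂ → ℂ) (hV : ∀ p, V p = ∑ ω ∈ K.powerset,
      if (↑ω : Set ι) ∈ A then ∏ e ∈ K, (if e ∈ ω then w p e else 1 - w p e) else 0) :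
    HasDerivAt V ((∑ e ∈ K, (if hor e then (1:ℝ) else -1) *
        (2 * (((K.erase e).powerset.filter
          (fun ω ↦ (↑(insert e ω) : Set ι) ∈ A ∧ (↑ω : Set ι) ∉ A)).card : ℝ) /
            (2:ℝ) ^ K.card) : ℝ) : ℂ)
      ((1:ℂ) / 2) := by
  -- normal form of the factors: affine, equal to `1/2` at `1/2`, slope `(±1)_{e ∈ ω} (±1)_{hor e}`
  have hfac : ∀ (ω : Finset ι) (e : ι) (p : ℂ), (if e ∈ ω then w p e else 1 - w p e) =
      1 / 2 + ((if e ∈ ω then (1:ℂ) else -1) * (if hor e then (1:ℂ) else -1)) * (p - 1 / 2) := by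
    intro ω e p
    rw [hw]
    split_ifs <;> ring
  have hVeq : V = fun p ↦ ∑ ω ∈ K.powerset, if (↑ω : Set ι) ∈ A then
      ∏ e ∈ K, (1 / 2 + ((if e ∈ ω then (1:ℂ) else -1) * (if hor e then (1:ℂ) else -1)) *
        (p - 1 / 2)) else 0 := by
    funext p
    rw [hV]
    simp_rw [hfac]
  have hlin : ∀ c : ℂ, HasDerivAt (fun p : ℂ ↦ 1 / 2 + c * (p - 1 / 2)) c ((1:ℂ) / 2) := by
    intro c
    have h := (((hasDerivAt_id' (x := (1:ℂ) / 2)).sub_const (1 / 2)).const_mul c).const_add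
      (1 / 2)
    rwa [mul_one] at h
  -- differentiate term by term
  have hderiv : HasDerivAt V (∑ ω ∈ K.powerset, if (↑ω : Set ι) ∈ A then
      ∑ e ∈ K, (∏ j ∈ K.erase e, ((1:ℂ) / 2 + ((if j ∈ ω then (1:ℂ) else -1) *
        (if hor j then (1:ℂ) else -1)) * ((1:ℂ) / 2 - 1 / 2))) •
          ((if e ∈ ω then (1:ℂ) else -1) * (if hor e then (1:ℂ) else -1)) else 0) ((1:ℂ) / 2) := by
    rw [hVeq]
    refine HasDerivAt.fun_sum fun ω _ ↦ ?_
    split_ifs with hωA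
    · exact HasDerivAt.fun_finsetProd fun e _ ↦ hlin _
    · exact hasDerivAt_const _ _
  refine hderiv.congr_deriv ?_
  -- the value of the derivative: all factors off `e` equal `1/2`
  simp only [sub_self, mul_zero, add_zero, Finset.prod_const, smul_eq_mul, ite_sum_else_zero]
  -- exchange the sums and pair `ω ↔ insert e ω`
  rw [Finset.sum_comm]
  push_cast
  refine Finset.sum_congr rfl fun e he ↦ ?_
  rw [sum_powerset_ite_mul_sign he hA, Finset.card_erase_of_mem he]
  -- `(1/2)^(|K| - 1) = 2 / 2^|K|`
  obtain ⟨m, hm⟩ : ∃ m, K.card = m + 1 :=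
    ⟨K.card - 1, by have := Finset.card_pos.2 ⟨e, he⟩; omega⟩
  rw [hm, Nat.add_sub_cancel, pow_succ, one_div_pow]
  split_ifs <;> push_cast <;> field_simp

/-! ### The stub -/

/-- **Stub `stub_firstJetRusso`** (line `birth` of crux `AnisotropicBoxCardy`): Russo's formula at
the self-dual point — the derivative at `p = 1/2` of the complex-anisotropy crossing amplitude
`V n` of the box `[0, n+1] × [0, n]` is the signed pivotal expectation
`E_½[N^piv_h − N^piv_v]`, as the finite count `Piv n`; exact for every `n`. -/
theorem stub_firstJetRusso :
    let E : ℕ → Finset (Sym2 (Literature.Probability.LatticeModels.Site 2)) := fun n ↦ ((Literature.Probability.Percolation.rectangle (n + 1) n ×ˢ Literature.Probability.Percolation.rectangle (n + 1) n).filter (fun xy ↦ (Literature.Probability.LatticeModels.zdGraph 2).Adj xy.1 xy.2)).image (fun xy ↦ s(xy.1, xy.2)); let w : ℂ → Sym2 (Literature.Probability.LatticeModels.Site 2) → ℂ := fun p e ↦ if (∃ x y : Literature.Probability.LatticeModels.Site 2, e = s(x, y) ∧ x 1 = y 1) then p else 1 - p; let V : ℕ → ℂ → ℂ := fun n p ↦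 ∑ ω ∈ (E n).powerset, (if ((ω : Set (Sym2 (Literature.Probability.LatticeModels.Site 2))) ∈ Literature.Probability.Percolation.lrCrossing (n + 1) n) then ∏ e ∈ E n, (if e ∈ ω then w p e else 1 - w p e) else 0); let Piv : ℕ → ℝ := fun n ↦ ∑ e ∈ E n, (if (∃ x y : Literature.Probability.LatticeModels.Site 2, e = s(x, y) ∧ x 1 = y 1) then (1:ℝ) else -1) * (2 * ((((E n).erase e).powerset.filter (fun ω ↦ ((↑(insert e ω) : Set (Sym2 (Literature.Probability.LatticeModels.Site 2))) ∈ Literature.Probability.Percolation.lrCrossing (n + 1) n) ∧ ((↑ω : Set (Sym2 (Literature.Probability.LatticeModels.Site 2))) ∉ Literature.Probability.Percolation.lrCrossing (n + 1) n))).card : ℝ) / (2:ℝ) ^ (E n).card); ∀ n : ℕ, deriv (V n) ((1:ℂ) / 2) = ((Piv n : ℝ) : ℂ) := by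
  intro E w V Piv n
  exact (hasDerivAt_twoColourCylinder_half (E n)
    (Literature.Probability.Percolation.isUpperSet_lrCrossing (n + 1) n)
    (fun e ↦ ∃ x y : Literature.Probability.LatticeModels.Site 2, e = s(x, y) ∧ x 1 = y 1)
    w (fun _ _ ↦ rfl) (V n) (fun _ ↦ rfl)).deriv

end Summit.CriticalPhenomena.CardyFormulaZ2.Theorems
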